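import Summits.ValiantsHypothesis.ValiantsHypothesis.Theorems.LacunarySymmetroidMatrixDescartesCensusPivotTwoDescartes
import Summits.ValiantsHypothesis.ValiantsHypothesis.Theorems.LacunarySymmetroidMatrixDescartesCensusTwistSum

/-!
# `MatrixDescartes` census — pivot column at `m = 2`: PIVOT ELIMINATION (every `K`, every index, every exponents)
# `Z₊(det F) ≤ (K+1) + Z₊(survivor)`, the survivor being the `J`-FREE product twist of `det (∑ X^{dₖ} Pₖ)`

HONEST FRAMING.  Object-search cell `pub-symmetroid`, Conjecture-B column in PIVOT currency (`…CensusPivotDefs.lean`,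
seat conjb-1), seat `val-sym-mdr-p1` (generation 6).  Helper file landed `--supports` the crux item
stmt-ValiantsHypothesis-18050 (`Theses.LacunarySymmetroid.MatrixDescartes`, OPEN, on HOLD) with NO closure claim.  A
REDUCTION LEMMA for the `(2, K)` pivot rows (`Z₊ ≤ 2K` conjectured by the seat; `= 6` at `K = 3`, `…PivotTwoThree`;
`≥ 8` at `K = 4`, `…PivotTwoFourWitness`; Descartes ceiling `2K + 2`, `…CensusPivotTwoDescartes`): the free letter `J` is
ELIMINATED at the cost of `K + 1` roots, uniformly.

THE LEMMA.  `F = X^e J + ∑ₖ X^{dₖ} Pₖ` a `2 × 2` pivot pencil (`J` ANY real `2 × 2` matrix — neither symmetry nor an index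
bound is used — and `Pₖ` arbitrary for the identity, `Pₖ ⪰ 0` for the sign statement), `A = ∑ₖ X^{dₖ} Pₖ` its PSD part,
`W = {2e} ∪ {e + dₖ}` the set of PIVOT DEGREES (`#W ≤ K + 1`).  The coefficients of `det F` and `det A` AGREE off `W`
(`coeff_det_eq_coeff_det_psdPart`: a coefficient of `det F` at `n ∉ W` is a sum of mixed discriminants of letters at
exponents `a + b = n` with `a, b ≠ e`), so the product Euler twist `T_W = ∏_{w ∈ W} (X·d/dX − w)`, which kills exactly the
degrees in `W` and multiplies the coefficient at `n` by `∏_{w∈W}(n − w)`, satisfies `T_W (det F) = T_W (det A)`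
(`twistSum_det_eq_twistSum_det_psdPart`) — the SURVIVOR is `J`-free.  By the tree's iterated twisted Rolle
(`Census.card_posRoots_le_card_posRoots_twistSum`, one root per twist):
  **`pivotPosRoots e d J P ≤ (K + 1) + Z₊(T_W (det A))`**  (`pivotPosRoots_le_succ_add_card_posRoots_survivor`),
and law-level (`pivotRootLawAt_two_of_survivor`): a bound `Z₊(T_W(det A)) ≤ B` uniform over the PSD data gives
`PivotRootLawAt 2 K q (K + 1 + B)` for every `q`.  The survivor's coefficients are `(∏_{w∈W}(n − w)) · coeff (det A) n`
with `coeff (det A) n ≥ 0` (`coeff_det_psdPart_nonneg`: sums of `det Pₖ` and mixed discriminants `mix(Pₖ, Pₗ)`), so its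
SIGN PATTERN is the parity of the number of pivot degrees above `n` — this is how the seat's census reads the `(2,4)` row:
on the `V = 10` sign chambers (82 order types at relative exponents `≤ 12`, memo of the seat) the survivor has `K + 1 = 5`
sign changes and the row `≤ 8 = 2K` is the statement «survivor `≤ 3`» (Descartes deficit two), located numerically,
not proved.  At `K = 3` the seat's predecessor proved exactly this deficit by one lever (`…WLawTwoSix`).

Nothing here bears on `Theses.LacunarySymmetroid.MatrixDescartes` in its window, on `KPlusLogSqLaw`, on `DoorA26` /
`DoorA34`, on the cell's registers or credences, or on `VP ≠ VNP`.

[folklore] Elementary (Euler twists / Rolle, `2 × 2` mixed discriminants); tree lemmas `Pivot.TwoDescartes.coeff_det`,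
`Pivot.TwoDescartes.coeff_det_nonneg_of_not_mem`, `Census.coeff_twistSum`, `Census.card_posRoots_le_card_posRoots_twistSum`.
No definitions, no named facts.
-/

-- `Summit.ValiantsHypothesis.ValiantsHypothesis.…` repeats a component by the D-0017 layout
-- (single-conjunct summit), which the `dupNamespace` linter flags; the name is mandated.
set_option linter.dupNamespace false

namespace Summit.ValiantsHypothesis.ValiantsHypothesis.Theorems.LacunarySymmetroidMatrixDescartes.Pivot.TwoElimination

open Polynomial Matrix Finset
open scoped BigOperators
open Pivot.TwoDescartes (letter expo pencil_eq_sum agg coeff_det agg_eq_zero coeff_det_nonneg_of_not_mem)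
open Census (card_posRoots_le_card_posRoots_twistSum coeff_twistSum)

variable {K : ℕ}

/-! ## 1. The PSD part as a pivot pencil with zero pivot letter -/

/-- The PSD part `∑ X^{dₖ} Pₖ` is the pivot pencil with pivot letter `0`, at any pivot exponent `e'`. [folklore] -/
theorem psdPart_eq_pencil_zero (e' : ℕ) (d : Fin K → ℕ) (P : Fin K → Matrix (Fin 2) (Fin 2) ℝ) :
    ∑ k, ((X : ℝ[X]) ^ d k) • (P k).map Polynomial.C
      = ((X : ℝ[X]) ^ e') • (0 : Matrix (Fin 2) (Fin 2) ℝ).map Polynomial.C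
        + ∑ k, ((X : ℝ[X]) ^ d k) • (P k).map Polynomial.C := by
  rw [Matrix.map_zero _ (map_zero _), smul_zero, zero_add]

/-- **Every coefficient of `det (∑ X^{dₖ} Pₖ)` is non-negative** for PSD `2 × 2` letters (each is a sum of determinants
`det Pₖ` and mixed discriminants `mix(Pₖ, Pₗ) ≥ 0`). [folklore] -/
theorem coeff_det_psdPart_nonneg (d : Fin K → ℕ) (P : Fin K → Matrix (Fin 2) (Fin 2) ℝ)
    (hP : ∀ k, (P k).PosSemidef) (n : ℕ) :
    0 ≤ (Matrix.det (∑ k, ((X : ℝ[X]) ^ d k) • (P k).map Polynomial.C)).coeff n := by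
  rw [psdPart_eq_pencil_zero (n + 1) d P, pencil_eq_sum]
  refine coeff_det_nonneg_of_not_mem (n + 1) d 0 P hP n fun l => ?_
  rcases l with _ | k
  · simp only [expo]; omega
  · simp only [expo]; omega

/-! ## 2. `det F` and `det A` agree off the pivot degrees -/

/-- Off the pivot exponent the aggregated letter does not see `J`. [folklore] -/
theorem agg_eq_agg_zero {e : ℕ} (d : Fin K → ℕ) (J : Matrix (Fin 2) (Fin 2) ℝ) (P : Fin K → Matrix (Fin 2) (Fin 2) ℝ)
    {a : ℕ} (ha : a ≠ e) : agg e d J P a = agg e d 0 P a := by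
  unfold agg
  refine Finset.sum_congr rfl fun l _ => ?_
  rcases l with _ | k
  · simp only [expo, if_neg (Ne.symm ha)]
  · rfl

/-- **Coefficients agree off `W`.**  If `n` is not a pivot degree (`n ≠ e + e` and `n ≠ e + dₖ` for all `k`), the
coefficient of `Xⁿ` in `det (X^e J + ∑ X^{dₖ} Pₖ)` equals that of `det (∑ X^{dₖ} Pₖ)` — for ANY real `2 × 2` matrices
`J, Pₖ`. [folklore] -/
theorem coeff_det_eq_coeff_det_psdPart (e : ℕ) (d : Fin K → ℕ) (J : Matrix (Fin 2) (Fin 2) ℝ)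
    (P : Fin K → Matrix (Fin 2) (Fin 2) ℝ) (n : ℕ) (hn : ∀ l, e + expo e d l ≠ n) :
    (Matrix.det (((X : ℝ[X]) ^ e) • J.map Polynomial.C
        + ∑ k, ((X : ℝ[X]) ^ d k) • (P k).map Polynomial.C)).coeff n
      = (Matrix.det (∑ k, ((X : ℝ[X]) ^ d k) • (P k).map Polynomial.C)).coeff n := by
  rw [pencil_eq_sum e d J P]
  conv_rhs => rw [psdPart_eq_pencil_zero e d P, pencil_eq_sum e d 0 P]
  rw [coeff_det, coeff_det]
  refine Finset.sum_congr rfl fun x hx => ?_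
  obtain ⟨a, b⟩ := x
  replace hx : a + b = n := by simpa using hx
  by_cases ha : a = e
  · have hb : ∀ l, expo e d l ≠ b := fun l hl => hn l (by rw [hl, ← hx, ha])
    simp only [agg_eq_zero e d J P b hb, agg_eq_zero e d 0 P b hb, Matrix.zero_apply, mul_zero, sub_self]
  by_cases hb : b = e
  · have ha' : ∀ l, expo e d l ≠ a := fun l hl => hn l (by rw [hl, ← hx, hb, add_comm])
    simp only [agg_eq_zero e d J P a ha', agg_eq_zero e d 0 P a ha', Matrix.zero_apply, zero_mul, sub_self]
  simp only [agg_eq_agg_zero d J P ha, agg_eq_agg_zero d J P hb]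

/-! ## 3. The product twist over the pivot degrees is `J`-free -/

/-- A pivot degree kills the twist multiplier: `n ∈ W ⇒ ∏_{w ∈ W} (n − w) = 0`. [folklore] -/
theorem prod_sub_eq_zero_of_mem {W : Finset ℕ} {n : ℕ} (hn : n ∈ W) : ∏ u ∈ W, ((n : ℝ) - u) = 0 :=
  Finset.prod_eq_zero hn (sub_self _)

/-- **The survivor is `J`-free.**  With `W = {e + e} ∪ {e + dₖ}` the set of pivot degrees, the product Euler twist
`T_W` (coefficient at `n` multiplied by `∏_{w∈W}(n − w)`) of `det (X^e J + ∑ X^{dₖ} Pₖ)` equals `T_W` of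
`det (∑ X^{dₖ} Pₖ)`, for ANY real `2 × 2` matrices `J, Pₖ`. [folklore] -/
theorem twistSum_det_eq_twistSum_det_psdPart (e : ℕ) (d : Fin K → ℕ) (J : Matrix (Fin 2) (Fin 2) ℝ)
    (P : Fin K → Matrix (Fin 2) (Fin 2) ℝ) :
    (∑ s ∈ (Matrix.det (((X : ℝ[X]) ^ e) • J.map Polynomial.C
        + ∑ k, ((X : ℝ[X]) ^ d k) • (P k).map Polynomial.C)).support,
        C ((Matrix.det (((X : ℝ[X]) ^ e) • J.map Polynomial.C
        + ∑ k, ((X : ℝ[X]) ^ d k) • (P k).map Polynomial.C)).coeff s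
          * ∏ u ∈ ((Finset.univ : Finset (Option (Fin K))).image (fun l => e + expo e d l)), ((s : ℝ) - u)) * X ^ s)
      = (∑ s ∈ (Matrix.det (∑ k, ((X : ℝ[X]) ^ d k) • (P k).map Polynomial.C)).support,
        C ((Matrix.det (∑ k, ((X : ℝ[X]) ^ d k) • (P k).map Polynomial.C)).coeff s
          * ∏ u ∈ ((Finset.univ : Finset (Option (Fin K))).image (fun l => e + expo e d l)), ((s : ℝ) - u)) * X ^ s) := by
  ext n
  rw [coeff_twistSum, coeff_twistSum]
  by_cases hn : n ∈ ((Finset.univ : Finset (Option (Fin K))).image (fun l => e + expo e d l))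
  · rw [prod_sub_eq_zero_of_mem hn, mul_zero, mul_zero]
  · have hn' : ∀ l, e + expo e d l ≠ n := fun l hl =>
      hn (Finset.mem_image.mpr ⟨l, Finset.mem_univ _, hl⟩)
    rw [coeff_det_eq_coeff_det_psdPart e d J P n hn']

/-! ## 4. PIVOT ELIMINATION -/

/-- The pivot degrees are at most `K + 1` in number. [folklore] -/
theorem card_pivotDegrees_le (e : ℕ) (d : Fin K → ℕ) :
    ((Finset.univ : Finset (Option (Fin K))).image (fun l => e + expo e d l)).card ≤ K + 1 :=
  le_trans Finset.card_image_le (by simp [Fintype.card_option])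

/-- **PIVOT ELIMINATION at `m = 2`** (every `K`, every exponents, `J` ANY real `2 × 2` matrix, `Pₖ` any).  With `W` the
pivot degrees and `g = det (∑ X^{dₖ} Pₖ)` the determinant of the PSD part,
`Z₊(det (X^e J + ∑ X^{dₖ} Pₖ)) ≤ (K + 1) + Z₊(T_W g)`, where `T_W g = ∑_{s ∈ supp g} (g_s ∏_{w∈W}(s − w)) X^s` is the
product Euler twist — the `J`-FREE survivor. [folklore] -/
theorem pivotPosRoots_le_succ_add_card_posRoots_survivor (e : ℕ) (d : Fin K → ℕ) (J : Matrix (Fin 2) (Fin 2) ℝ)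
    (P : Fin K → Matrix (Fin 2) (Fin 2) ℝ) :
    pivotPosRoots e d J P ≤ (K + 1) +
      ((∑ s ∈ (Matrix.det (∑ k, ((X : ℝ[X]) ^ d k) • (P k).map Polynomial.C)).support,
        C ((Matrix.det (∑ k, ((X : ℝ[X]) ^ d k) • (P k).map Polynomial.C)).coeff s
          * ∏ u ∈ ((Finset.univ : Finset (Option (Fin K))).image (fun l => e + expo e d l)), ((s : ℝ) - u))
          * X ^ s).roots.toFinset.filter (fun t => 0 < t)).card := by
  unfold pivotPosRoots
  have h := card_posRoots_le_card_posRoots_twistSum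
    (Matrix.det (((X : ℝ[X]) ^ e) • J.map Polynomial.C
        + ∑ k, ((X : ℝ[X]) ^ d k) • (P k).map Polynomial.C))
    ((Finset.univ : Finset (Option (Fin K))).image (fun l => e + expo e d l))
  rw [twistSum_det_eq_twistSum_det_psdPart e d J P] at h
  have hW := card_pivotDegrees_le e d
  exact h.trans (by omega)

/-- **Law-level form.**  If for fixed `K` the `J`-free survivor of every `2 × 2` pivot pencil with PSD letters has at most
`B` distinct positive roots, then `PivotRootLawAt 2 K q (K + 1 + B)` for every index `q`.  (The conjectured row
`Z₊ ≤ 2K` is the case `B = K − 1`: Descartes deficit two for the survivor on the `V = 2K + 2` sign chambers.) [folklore] -/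
theorem pivotRootLawAt_two_of_survivor (K q B : ℕ)
    (h : ∀ (e : ℕ) (d : Fin K → ℕ) (P : Fin K → Matrix (Fin 2) (Fin 2) ℝ), (∀ k, (P k).PosSemidef) →
      ((∑ s ∈ (Matrix.det (∑ k, ((X : ℝ[X]) ^ d k) • (P k).map Polynomial.C)).support,
        C ((Matrix.det (∑ k, ((X : ℝ[X]) ^ d k) • (P k).map Polynomial.C)).coeff s
          * ∏ u ∈ ((Finset.univ : Finset (Option (Fin K))).image (fun l => e + expo e d l)), ((s : ℝ) - u))
          * X ^ s).roots.toFinset.filter (fun t => 0 < t)).card ≤ B) :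
    PivotRootLawAt 2 K q (K + 1 + B) := by
  intro e d J P _hJ hP _hW
  have h1 := pivotPosRoots_le_succ_add_card_posRoots_survivor e d J P
  have h2 := h e d P hP
  omega

/-! ## 5. The survivor's coefficients: magnitude from the PSD part, sign from the position among the pivot degrees -/

/-- **Coefficients of the survivor.**  At degree `n` the survivor's coefficient is `(∏_{w∈W}(n − w)) · coeff (det A) n`
with `coeff (det A) n ≥ 0`; in particular it vanishes on `W`, and elsewhere its sign is `(−1)^{#{w ∈ W : n < w}}` times a
non-negative number. [folklore] -/
theorem coeff_survivor (e : ℕ) (d : Fin K → ℕ) (P : Fin K → Matrix (Fin 2) (Fin 2) ℝ)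
    (hP : ∀ k, (P k).PosSemidef) (n : ℕ) :
    (∑ s ∈ (Matrix.det (∑ k, ((X : ℝ[X]) ^ d k) • (P k).map Polynomial.C)).support,
        C ((Matrix.det (∑ k, ((X : ℝ[X]) ^ d k) • (P k).map Polynomial.C)).coeff s
          * ∏ u ∈ ((Finset.univ : Finset (Option (Fin K))).image (fun l => e + expo e d l)), ((s : ℝ) - u)) * X ^ s).coeff n
        = (Matrix.det (∑ k, ((X : ℝ[X]) ^ d k) • (P k).map Polynomial.C)).coeff n
          * ∏ u ∈ ((Finset.univ : Finset (Option (Fin K))).image (fun l => e + expo e d l)), ((n : ℝ) - u)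
      ∧ 0 ≤ (Matrix.det (∑ k, ((X : ℝ[X]) ^ d k) • (P k).map Polynomial.C)).coeff n :=
  ⟨coeff_twistSum _ _ n, coeff_det_psdPart_nonneg d P hP n⟩

end Summit.ValiantsHypothesis.ValiantsHypothesis.Theorems.LacunarySymmetroidMatrixDescartes.Pivot.TwoElimination
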